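import Summits.QuantumFields.YangMills.Theorems.UnitScaleTiltHalvingStepOfPillarsCEMemberStat
import Summits.QuantumFields.YangMills.Theorems.UnitScaleTiltHalvingCompetitorMapFibreSmooth
import Summits.QuantumFields.YangMills.Theorems.UnitScaleTiltHalvingCompetitorRegularOpen
import Summits.QuantumFields.YangMills.Theorems.UnitScaleTiltHalvingStepOfPillarsCERows
import Summits.QuantumFields.YangMills.Theorems.UnitScaleTiltProp8HalvingDressedCriticalitySU2
import Summits.QuantumFields.YangMills.Theorems.UnitScaleTiltHalvingRhoLinearBricks
import HarnessLib

/-!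
# Crux «MinimiserStabilityRegPr» (stmt-QuantumFields-19200), stub `stub_halvingStep` — **LEAD-H RULING L-11 v2 (ρ-WINDOW): THE C_E ROWS, GROWTH-EXPOSED**:
# ✓`ceRows_of_chart_stat` (L4-Stat, ★w8-19200 g2) RESTATED with `∃ Nce k₁ k₂ c₂ ace` BEFORE `∀ B₁ ≥ 0` and the rows read at `K₁ := k₁(B₁+1)²`, `K₂ := k₂(B₁+1)²`,
# `C₂ := c₂(B₁+1)`, `Cce := 0`, `aCE := ace∕(B₁+1)` — exactly how the original proof builds them; proof VERBATIM (cited) with the constants hoisted.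
Cell `ym3-torus` (D-0037, rung R3 — NOT Clay), seat `ym-ust-19200-w5` gen 5 (LEAD-H); `--supports stmt-QuantumFields-19200 --as helper`; def-free, 0 sorry; nothing of the
stub∕crux∕gap claimed.  WHY (`LOCATE-RHO-WINDOW-w5g5.md` v2): the H door must read the P1♭ size constant ρ-linearly (`B₁ ↦ B₁·(ρ+1)`), and its inner radius `ρ` is
chosen by (163) from a package constant `≥ C₂(B₁(ρ))` — circular unless the GROWTH of the C_E constants in `B₁` is displayed (this file; linear (163) in
✓`HalvingRhoLinearBricks`, door ✓`HalvingStubOfHP1RoomRho2`).  References: T. Bałaban, CMP **102** (1985) 277–309 [Balaban1985Variational] (44)–(49) p.285, (55) p.286,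
(99) p.293, (150)–(165) pp.301–303, Prop. 8 p.304; CMP **99** (1985) 75–102 [Balaban1985RegularSpaces] Thm 2 p.83.
-/
set_option autoImplicit false
noncomputable section
open scoped BigOperators Matrix Matrix.Norms.L2Operator
open NormedSpace
namespace Summit.QuantumFields.YangMills.Theorems.HalvingSitePackage

open Literature.MathematicalPhysics.QuantumFieldTheory.Balaban1983to89
open Literature.MathematicalPhysics.QuantumFieldTheory.Balaban1983to89.T3ContinuumYM3Torus
open Literature.MathematicalPhysics.QuantumFieldTheory.Balaban1983to89.T3PrintedRegularMinimiser
open Literature.MathematicalPhysics.QuantumFieldTheory.Balaban1983to89.T3Thm1Carrier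
open Complex (I)
open B5Eq117TorusCarriers (Mk)
open B5Eq118OneStroke (iterBlockOf)
open B5Prop12FieldsLattice (distSite)
open B6GlobalChartV1 (PV)
open B6SectADomainsV1 (Domains)
open B6SectAOperatorsV1 (BondIdx SiteIdx QE RE dsE)
open B7Prop1Explicit (expUnit)
open B8Ineq132 (BondTouches)
open B8Eq140Level (SideTouches)
open B8Eq143PlaqExpansion (pdiv)
open B8Eq146AExpansion (plaqCovDeriv)
open B8Thm2SetupTorus (pullDom)
open B10Eq27TorusAxialLog (pull unitsField toUField transl)
open B11Eq115Space (levOf)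
open LatticeFieldCalculus (bondAvgIter laplace diverg siteAvgIter)
open FlatCubeOpsText (Adm22 IsLevWeight FlatOpsAdmAtMS HDecayLetterD RowSum162 distBI)
open FlatOpsLettersAssembly (flatH isFlatH_flatH levWeight_nonneg)
open FlatCubeSequenceAligned (cubeSeqMT3 cubeSeqMT3_k cubeSetM)
open FlatCubeSequenceAdm (adm22_cubeSeqMT3)
open HalvingP1FlatPillar (DP1Clause)
open Prop8ChartDoubleBar (chartLogFlat chartRemainderFlat_hCd_hCq_B1 dressed_competitor_su2)
open Literature.MathematicalPhysics.QuantumFieldTheory.Balaban1983to89.T3UnitLawDensityEML (ℰp)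
open Literature.MathematicalPhysics.QuantumFieldTheory.Balaban1983to89.T3ConstrainedMinimiser (fibre)
open HalvingDressingLetter (exists_hWq_dressed_cubeSeq_T3_chartOfRecord_closed_allSizes_allL)
open HalvingA1Row165AllSizesAllL (row165_of_tracePairing_su2_allSizes_allL)
open HalvingCompetitorMapFibreSmooth (exists_smoothGauge_mem_fibre_of_chart49_line)
open HalvingCompetitorRegularOpen (exists_lineRadius_regPr_of_differentiableAt_bonds regPr_gaugeAct_of_mem_regFibrePr)
open Prop8ChartDoubleBar (exists_lineRadius_of_mem_weightedBall)
open HalvingCENear (near_sides_of_touch lamBond_sides_of_not_touch hchartNear_of_hii')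
open P1FlatCoreTopCubeGeometry (near_of_bondIdx near_of_mem_Om_succ)
open HalvingRhoLinearBricks (r_le_growth e₁_bound_growth)

/-! ## §2 The theorem -/
-- heartbeat budget (HOME README rule): the L3″ call unifies ~60 binders across the `F.P K`∕`PV` letters (isDefEq-heavy; 200k fails, 400k passes in 45 s farm wall); budgeted 400k on this declaration only
set_option maxHeartbeats 400000 in
/-- ★★ **THE C_E ROWS OF THE STATIONARITY-CURRENCY H-DOOR, GROWTH-EXPOSED (RULING L-11 v2)** — ✓`ceRows_of_chart_stat`'s text with `∃ Nce k₁ k₂ c₂ ace`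
hoisted BEFORE `∀ B₁ ≥ 0` and the constants read `K₁ := k₁(B₁+1)²`, `K₂ := k₂(B₁+1)²`, `C₂ := c₂(B₁+1)`, `Cce := 0`, `aCE := ace∕(B₁+1)`; same proof.
[cite: Balaban1985Variational, (44)-(49) p.285, (55) p.286, (99) p.293, (150)-(165) pp.301-303, Prop. 8 p.304; Balaban1985RegularSpaces, Thm 2 p.83] -/
theorem ceRows_of_chart_stat_growth_room :
    ∀ L : ℕ, Odd L → 1 < L → ∀ (R₀ M₀ : ℕ) (B₀ δ₀ B₃ : ℝ), 0 < B₀ → 0 < δ₀ → 0 < B₃ → FlatOpsAdmAtMS L R₀ M₀ B₀ δ₀ B₃ →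
      ∃ (M₁ R₁ : ℕ), ∀ (R M aₑ S : ℕ) (hM : 1 ≤ M), M = L ^ aₑ → M₁ ≤ M → M₀ ≤ M → R₁ ≤ R → R₀ ≤ R → R * M ≤ S →
      ∃ (Nce : ℕ) (k₁ k₂ c₂ ace : ℝ), 0 ≤ k₁ ∧ 0 ≤ k₂ ∧ 0 ≤ c₂ ∧ 0 < ace ∧
      ∀ B₁ : ℝ, 0 ≤ B₁ →
      ∀ ρ : ℕ, 1 ≤ ρ → ∀ F : T3Family, F.L = L → ∀ (n K : ℕ) (hnK : n < K), Nce ≤ F.L ^ (F.m + n) →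
        ∀ (ε₀ ε₁ : ℝ), 0 < ε₁ → 0 < ε₀ → ε₀ ≤ ace / (B₁ + 1) →
        ∀ V : GaugeField (F.P n) 0 (Matrix.specialUnitaryGroup (Fin 2) ℂ), PlaqSmall ε₁ V →
          ∀ U ∈ regFibrePr F n K hnK.le ε₀ V,
            (∀ γ : ℝ → GaugeField (F.P K) 0 (Matrix.specialUnitaryGroup (Fin 2) ℂ), γ 0 = U → (∀ t, γ t ∈ fibre F ℰp n K hnK.le V) →
              (∀ b, DifferentiableAt ℝ (fun t => ((γ t b : Matrix.specialUnitaryGroup (Fin 2) ℂ) : Matrix (Fin 2) (Fin 2) ℂ)) 0) →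
                deriv (fun t => wilsonAction4 (γ t)) 0 = 0) →
            ∀ (x : Site (F.P K) 0) (C₂' : ℝ) (u : GaugeTransf (F.P K) 0 (Matrix.unitaryGroup (Fin 2) ℂ)) (A : PBond (F.P K) 0 → Matrix (Fin 2) (Fin 2) ℂ),
              -- the seven conjuncts of `P1FlatPillarAt' F n K (cubeSeqMT3 …) (cubeSetM x (K−n) ρ S M 0) x ε₀ ε₁ B₁ 6 C₂' U` for THIS pair `(u, A)` ((ii′) on `□₀`)
              DP1Clause F n K (cubeSeqMT3 F n K x ρ S M hM) x U u →
              (∀ b : PBond (F.P K) 0, IsSelfAdjoint (A b)) → (∀ b : PBond (F.P K) 0, Matrix.trace (A b) = 0) →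
              (∀ (z : B7Prop1Explicit.Site (F.P K).d) (μ : Fin (F.P K).d),
                transl (0 : Site (F.P K) 0) z ∈ cubeSetM x (K - n) ρ S M 0 → (transl (0 : Site (F.P K) 0) z).shift μ ∈ cubeSetM x (K - n) ρ S M 0 →
                (Unitary.toUnits (u (transl 0 z)))⁻¹ * unitsField (toUField U) ⟨transl 0 z, μ⟩ * Unitary.toUnits (u ((transl 0 z).shift μ)) =
                  expUnit (I • ((((F.L : ℝ)⁻¹) ^ (K - n)) • A ⟨transl 0 z, μ⟩))) →
              (∀ w : ℕ → PBond (F.P K) 0 → ℝ, IsLevWeight F n K (cubeSeqMT3 F n K x ρ S M hM) w →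
                (∀ b : PBond (F.P K) 0, w 1 b * ‖A b‖ ≤ B₁ * ε₀) ∧
                (∀ (b : PBond (F.P K) 0) (ν : Fin (F.P K).d), w 2 b * (F.L : ℝ) ^ (K - n) * ‖A ⟨b.src.shift ν, b.dir⟩ - A b‖ ≤ B₁ * ε₀)) →
              (∃ μ : SiteIdx (cubeSeqMT3 F n K x ρ S M hM) → Matrix (Fin 2) (Fin 2) ℂ, ∀ s : Site (F.P K) 0,
                laplace ((F.L : ℝ) ^ (K - n)) (diverg ((F.L : ℝ) ^ (K - n)) A) s =
                  ∑ i : SiteIdx (cubeSeqMT3 F n K x ρ S M hM), siteAvgIter (i.1.1 : ℕ) (Pi.single s (1 : ℝ)) i.1.2 • μ i) →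
              (∀ c : BondIdx (cubeSeqMT3 F n K x ρ S M hM), (c.1.1 : ℕ) = K - n →
                c.1.2.src ∈ (cubeSeqMT3 F n K x ρ S M hM).Om (c.1.1 : ℕ) → c.1.2.tgt ∈ (cubeSeqMT3 F n K x ρ S M hM).Om (c.1.1 : ℕ) →
                ‖chartLogFlat (((F.L : ℝ)⁻¹) ^ (K - n)) (cubeSeqMT3 F n K x ρ S M hM) A c‖ ≤
                  6 * ε₁ * (distSite (Mk (F.P K) (c.1.1 : ℕ)) c.1.2.src (iterBlockOf (c.1.1 : ℕ) x) + 1)) →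
              (∀ c : BondIdx (cubeSeqMT3 F n K x ρ S M hM), ‖chartLogFlat (((F.L : ℝ)⁻¹) ^ (K - n)) (cubeSeqMT3 F n K x ρ S M hM) A c‖ ≤ C₂' * ε₀) →
              -- OUTPUT: `sitePackage_of_rows`'s rows for some `Hs`, `C`, `e₁`, `e₃`
              ∃ (Hs : (BondIdx (cubeSeqMT3 F n K x ρ S M hM) → Matrix (Fin 2) (Fin 2) ℂ) → (PBond (F.P K) 0 → Matrix (Fin 2) (Fin 2) ℂ))
                (C : (PBond (F.P K) 0 → Matrix (Fin 2) (Fin 2) ℂ) → (BondIdx (cubeSeqMT3 F n K x ρ S M hM) → Matrix (Fin 2) (Fin 2) ℂ))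
                (e₁ e₃ : ℝ),
                ((∀ (z : B7Prop1Explicit.Site (F.P K).d) (τ : Fin (F.P K).d),
                    SideTouches (pullDom (fun j => if K - n ≤ j then ({x} : Set (Site (F.P K) 0)) else (∅ : Set (Site (F.P K) 0))) (K - n)) z τ →
                    ‖((A + Hs (C A)) - fun b : PBond (F.P K) 0 => ∑ c, flatH F n K (cubeSeqMT3 F n K x ρ S M hM) (Pi.single c 1) b •
                        bondAvgIter (c.1.1 : ℕ) (A + Hs (C A)) c.1.2) ⟨transl 0 z, τ⟩‖ ≤ e₁) ∧
                  (∀ (z : B7Prop1Explicit.Site (F.P K).d) (κ τ : Fin (F.P K).d),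
                    SideTouches (pullDom (fun j => if K - n ≤ j then ({x} : Set (Site (F.P K) 0)) else (∅ : Set (Site (F.P K) 0))) (K - n)) z τ →
                    ‖(((F.L : ℝ)⁻¹) ^ (K - n))⁻¹ •
                      (((A + Hs (C A)) - fun b : PBond (F.P K) 0 => ∑ c, flatH F n K (cubeSeqMT3 F n K x ρ S M hM) (Pi.single c 1) b •
                          bondAvgIter (c.1.1 : ℕ) (A + Hs (C A)) c.1.2) ⟨(transl 0 z).shift κ, τ⟩ -
                        ((A + Hs (C A)) - fun b : PBond (F.P K) 0 => ∑ c, flatH F n K (cubeSeqMT3 F n K x ρ S M hM) (Pi.single c 1) b •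
                          bondAvgIter (c.1.1 : ℕ) (A + Hs (C A)) c.1.2) ⟨transl 0 z, τ⟩)‖ ≤ e₁) ∧
                  (∀ (z : B7Prop1Explicit.Site (F.P K).d) (μ : Fin (F.P K).d),
                    BondTouches (pullDom (fun j => if K - n ≤ j then ({x} : Set (Site (F.P K) 0)) else (∅ : Set (Site (F.P K) 0))) (K - n)) z μ →
                    ‖pdiv (((F.L : ℝ)⁻¹) ^ (K - n)) (1 : B7Prop1Explicit.Site (F.P K).d → Fin (F.P K).d → (Matrix (Fin 2) (Fin 2) ℂ)ˣ)
                        (plaqCovDeriv (((F.L : ℝ)⁻¹) ^ (K - n)) (1 : B7Prop1Explicit.Site (F.P K).d → Fin (F.P K).d → (Matrix (Fin 2) (Fin 2) ℂ)ˣ)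
                          (pull ((A + Hs (C A)) - fun b : PBond (F.P K) 0 => ∑ c, flatH F n K (cubeSeqMT3 F n K x ρ S M hM) (Pi.single c 1) b •
                            bondAvgIter (c.1.1 : ℕ) (A + Hs (C A)) c.1.2) 0)) μ z‖ ≤ e₁)) ∧
                ((∀ (z : B7Prop1Explicit.Site (F.P K).d) (τ : Fin (F.P K).d),
                    SideTouches (pullDom (fun j => if K - n ≤ j then ({x} : Set (Site (F.P K) 0)) else (∅ : Set (Site (F.P K) 0))) (K - n)) z τ →
                    ‖Hs (C A) ⟨transl 0 z, τ⟩‖ ≤ e₃) ∧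
                  (∀ (z : B7Prop1Explicit.Site (F.P K).d) (κ τ : Fin (F.P K).d),
                    SideTouches (pullDom (fun j => if K - n ≤ j then ({x} : Set (Site (F.P K) 0)) else (∅ : Set (Site (F.P K) 0))) (K - n)) z τ →
                    ‖(((F.L : ℝ)⁻¹) ^ (K - n))⁻¹ • (Hs (C A) ⟨(transl 0 z).shift κ, τ⟩ - Hs (C A) ⟨transl 0 z, τ⟩)‖ ≤ e₃) ∧
                  (∀ (z : B7Prop1Explicit.Site (F.P K).d) (μ : Fin (F.P K).d),
                    BondTouches (pullDom (fun j => if K - n ≤ j then ({x} : Set (Site (F.P K) 0)) else (∅ : Set (Site (F.P K) 0))) (K - n)) z μ →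
                    ‖pdiv (((F.L : ℝ)⁻¹) ^ (K - n)) (1 : B7Prop1Explicit.Site (F.P K).d → Fin (F.P K).d → (Matrix (Fin 2) (Fin 2) ℂ)ˣ)
                        (plaqCovDeriv (((F.L : ℝ)⁻¹) ^ (K - n)) (1 : B7Prop1Explicit.Site (F.P K).d → Fin (F.P K).d → (Matrix (Fin 2) (Fin 2) ℂ)ˣ)
                          (pull (Hs (C A)) 0)) μ z‖ ≤ e₃)) ∧
                (∀ c : BondIdx (cubeSeqMT3 F n K x ρ S M hM), (c.1.1 : ℕ) = K - n →
                  c.1.2.src ∈ (cubeSeqMT3 F n K x ρ S M hM).Om (c.1.1 : ℕ) → c.1.2.tgt ∈ (cubeSeqMT3 F n K x ρ S M hM).Om (c.1.1 : ℕ) →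
                  ‖bondAvgIter (c.1.1 : ℕ) (A + Hs (C A)) c.1.2‖ ≤ 6 * ε₁ * (distSite (Mk (F.P K) (c.1.1 : ℕ)) c.1.2.src (iterBlockOf (c.1.1 : ℕ) x) + 1)) ∧
                (∀ c : BondIdx (cubeSeqMT3 F n K x ρ S M hM),
                  ¬ ((c.1.1 : ℕ) = K - n ∧ c.1.2.src ∈ (cubeSeqMT3 F n K x ρ S M hM).Om (c.1.1 : ℕ) ∧
                      c.1.2.tgt ∈ (cubeSeqMT3 F n K x ρ S M hM).Om (c.1.1 : ℕ)) →
                  ‖bondAvgIter (c.1.1 : ℕ) (A + Hs (C A)) c.1.2‖ ≤ c₂ * (B₁ + 1) * ε₀ * (F.L : ℝ) ^ ((K - n) - (c.1.1 : ℕ))) ∧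
                e₁ ≤ k₁ * (B₁ + 1) ^ 2 * ε₀ ^ 2 ∧ e₃ ≤ k₂ * (B₁ + 1) ^ 2 * ε₀ ^ 2 := by

  classical
  intro L hodd hL1 R₀ M₀ B₀ δ₀ B₃ hB₀ hδ₀ hB₃ hP2L
  obtain ⟨ℓ, rfl⟩ : ∃ ℓ, L = ℓ + 1 := ⟨L - 1, by omega⟩
  have hLℓ : Odd (ℓ + 1) ∧ 1 < ℓ + 1 := ⟨hodd, hL1⟩
  obtain ⟨Mh₀E, R₀E, BH, CX, K₀, CP, hBH, hCX, hK₀, hCP, ε, Rc₀, a₃, ha₃, ha₃R, hRcε, h3ε, hq9, hR', hθ, hEall⟩ :=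
    exists_hWq_dressed_cubeSeq_T3_chartOfRecord_closed_allSizes_allL ℓ hLℓ
  obtain ⟨Mh₀r, R₀r, B₀r, BM, hB₀r, hBM, h165all⟩ := row165_of_tracePairing_su2_allSizes_allL ℓ hLℓ
  refine ⟨(ℓ + 1) * max (max Mh₀E Mh₀r) 1, max (max R₀E R₀r) (2 * (ℓ + 1)), ?_⟩
  intro R M aₑ S hM hMeq hM₁ hM₀ hR₁ hR₀ hRS
  -- the size seam: `M = L^{aₑ} ≥ L` forces `aₑ = a′ + 1`, `M = L·L^{a′}`
  have haₑ : aₑ ≠ 0 := by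
    rintro rfl
    rw [pow_zero] at hMeq
    have : (ℓ + 1) * 1 ≤ (ℓ + 1) * max (max Mh₀E Mh₀r) 1 := Nat.mul_le_mul_left _ (le_max_right _ _)
    omega
  obtain ⟨a', rfl⟩ := Nat.exists_eq_succ_of_ne_zero haₑ
  rw [pow_succ'] at hMeq
  subst hMeq
  have hMh : max (max Mh₀E Mh₀r) 1 ≤ (ℓ + 1) ^ a' := Nat.le_of_mul_le_mul_left hM₁ (Nat.succ_pos ℓ)
  have hMhE : Mh₀E ≤ (ℓ + 1) ^ a' := ((le_max_left _ _).trans (le_max_left _ _)).trans hMh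
  have hMhr : Mh₀r ≤ (ℓ + 1) ^ a' := ((le_max_right _ _).trans (le_max_left _ _)).trans hMh
  have hR₀E : R₀E ≤ R := ((le_max_left _ _).trans (le_max_left _ _)).trans hR₁
  have hR₀r : R₀r ≤ R := ((le_max_right _ _).trans (le_max_left _ _)).trans hR₁
  have hR2L : 2 * (ℓ + 1) ≤ R := (le_max_right _ _).trans hR₁
  have hRM : 2 * (ℓ + 1) ≤ R * ((ℓ + 1) * (ℓ + 1) ^ a') := hR2L.trans (Nat.le_mul_of_pos_right R hM)
  have hL0 : (0 : ℝ) < ((ℓ + 1 : ℕ) : ℝ) := by positivity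
  have hL1r : (1 : ℝ) ≤ ((ℓ + 1 : ℕ) : ℝ) := by exact_mod_cast Nat.succ_le_succ (Nat.zero_le ℓ)
  have hden : (0 : ℝ) < 16 * 3800 * ((((2 + 1 + 2) * (ℓ + 1) : ℕ)) : ℝ) ^ 2 * ((ℓ + 1 : ℕ) : ℝ) := by positivity
  have hRs0 : (0 : ℝ) < (16 * 3800 * ((((2 + 1 + 2) * (ℓ + 1) : ℕ)) : ℝ) ^ 2 * ((ℓ + 1 : ℕ) : ℝ))⁻¹ := inv_pos.2 hden
  have hC2f0 : (0 : ℝ) ≤ 64 * ((ℓ + 1 : ℕ) : ℝ) / (16 * 3800 * ((((2 + 1 + 2) * (ℓ + 1) : ℕ)) : ℝ) ^ 2 * ((ℓ + 1 : ℕ) : ℝ))⁻¹ := by positivity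
  -- `0 < Rc₀`, `0 < ε` (read by `positivity` below)
  have hRc0 : 0 < Rc₀ := ha₃.trans_le ha₃R
  have hε0 : 0 < ε := hRc0.trans hRcε
  have ha₃1 : a₃ ≤ 1 := by
    have h0 : 0 ≤ 4 * BH * (64 * ((ℓ + 1 : ℕ) : ℝ) / (16 * 3800 * ((((2 + 1 + 2) * (ℓ + 1) : ℕ)) : ℝ) ^ 2 * ((ℓ + 1 : ℕ) : ℝ))⁻¹) * Rc₀ := by
      positivity
    have h2 := le_mul_of_one_le_left ha₃.le (le_add_of_nonneg_right h0)
    have h3 : 1 / (2 * ((ℓ + 1 : ℕ) : ℝ)) ≤ 1 := by rw [div_le_one (by positivity)]; linarith only [hL1r]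
    linarith only [h2, hθ, h3]
  set C2f : ℝ := 64 * ((ℓ + 1 : ℕ) : ℝ) / (16 * 3800 * ((((2 + 1 + 2) * (ℓ + 1) : ℕ)) : ℝ) ^ 2 * ((ℓ + 1 : ℕ) : ℝ))⁻¹ with hC2fdef
  set C₄ℓ : ℝ := (12 * (((ℓ + 1 : ℕ) : ℝ) ^ 3 * (1428 + ((ℓ + 1 : ℕ) : ℝ))) * (1 + 4 * BH * (64 * ((ℓ + 1 : ℕ) : ℝ) / (16 * 3800 * ((((2 + 1 + 2) * (ℓ + 1) : ℕ)) : ℝ) ^ 2 * ((ℓ + 1 : ℕ) : ℝ))⁻¹) * Rc₀) ^ 2 +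
              (2 * CX * (64 * ((ℓ + 1 : ℕ) : ℝ) / (16 * 3800 * ((((2 + 1 + 2) * (ℓ + 1) : ℕ)) : ℝ) ^ 2 * ((ℓ + 1 : ℕ) : ℝ))⁻¹) + 2⁻¹ * (8 * (7 * (9830400000 * ((ℓ + 1 : ℕ) : ℝ) ^ 4) * (1 + 4 * BH * (64 * ((ℓ + 1 : ℕ) : ℝ) / (16 * 3800 * ((((2 + 1 + 2) * (ℓ + 1) : ℕ)) : ℝ) ^ 2 * ((ℓ + 1 : ℕ) : ℝ))⁻¹) * ε)) * (2 * CP)) * (1 + 4 * BH * (64 * ((ℓ + 1 : ℕ) : ℝ) / (16 * 3800 * ((((2 + 1 + 2) * (ℓ + 1) : ℕ)) : ℝ) ^ 2 * ((ℓ + 1 : ℕ) : ℝ))⁻¹) * Rc₀) +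
                (16 * K₀ * (7 * (9830400000 * ((ℓ + 1 : ℕ) : ℝ) ^ 4) * (1 + 4 * BH * (64 * ((ℓ + 1 : ℕ) : ℝ) / (16 * 3800 * ((((2 + 1 + 2) * (ℓ + 1) : ℕ)) : ℝ) ^ 2 * ((ℓ + 1 : ℕ) : ℝ))⁻¹) * ε))) * Rc₀ * (12 * (((ℓ + 1 : ℕ) : ℝ) ^ 3 * (1428 + ((ℓ + 1 : ℕ) : ℝ)))) * (1 + 4 * BH * (64 * ((ℓ + 1 : ℕ) : ℝ) / (16 * 3800 * ((((2 + 1 + 2) * (ℓ + 1) : ℕ)) : ℝ) ^ 2 * ((ℓ + 1 : ℕ) : ℝ))⁻¹) * Rc₀) ^ 2)) with hC₄ℓdef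
  have hC₄ℓ0 : 0 ≤ C₄ℓ := by rw [hC₄ℓdef]; positivity
  -- the GROWTH constants (before `B₁`): `k₁ k₂ c₂ ace`
  set ace : ℝ := min (10 ^ 7 * ((ℓ + 1 : ℕ) : ℝ) ^ 3)⁻¹ (a₃ / (2 * (1 + BH * C2f))) with hacedef
  have hBC0 : 0 < 2 * (1 + BH * C2f) := by positivity
  have hace0 : 0 < ace := lt_min (by positivity) (div_pos ha₃ hBC0)
  refine ⟨0, max B₀r (1 + BM) * (4 * C₄ℓ * (1 + BH * C2f) ^ 2), B₀ * B₃ * C2f, ((ℓ + 1 : ℕ) : ℝ) * (1 + BH * C2f), ace,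
    by positivity, by positivity, by positivity, hace0, ?_⟩
  intro B₁ hB₁ ρ hρ1 F hF n K hnK _hNce ε₀ ε₁ hε₁ hε₀ hε₀a V _hV U hU hstat x C₂' u A _ho hsa htr hii hiii hiv hvi _hvii
  obtain ⟨L', hLF, m, hm⟩ := F
  change L' = ℓ + 1 at hF
  subst hF
  -- the per-`B₁` ceiling of the original proof, implied by `ε₀ ≤ ace∕(B₁+1)`
  set aCE : ℝ := min (10 ^ 7 * ((ℓ + 1 : ℕ) : ℝ) ^ 3)⁻¹ (a₃ / (2 * (1 + BH * C2f) * (B₁ + 1))) with haCEdef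
  have hBC : 0 < 2 * (1 + BH * C2f) * (B₁ + 1) := by positivity
  have hB11 : 1 ≤ B₁ + 1 := by linarith only [hB₁]
  have hε₀aCE : ε₀ ≤ aCE := by
    refine hε₀a.trans (le_min ?_ ?_)
    · exact (div_le_self hace0.le hB11).trans (min_le_left _ _)
    · calc ace / (B₁ + 1) ≤ (a₃ / (2 * (1 + BH * C2f))) / (B₁ + 1) :=
            div_le_div_of_nonneg_right (min_le_right _ _) (by linarith only [hB₁])
        _ = a₃ / (2 * (1 + BH * C2f) * (B₁ + 1)) := by rw [div_div]
  -- numerics at this member: `δ := B₁ε₀`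
  have haCEa : aCE ≤ a₃ / (2 * (1 + BH * C2f) * (B₁ + 1)) := min_le_right _ _
  have hδ0 : 0 ≤ B₁ * ε₀ := mul_nonneg hB₁ hε₀.le
  have hε7 : 10 ^ 7 * ((ℓ + 1 : ℕ) : ℝ) ^ 3 * ε₀ ≤ 1 := by
    have h7 : (0 : ℝ) < 10 ^ 7 * ((ℓ + 1 : ℕ) : ℝ) ^ 3 := by positivity
    exact (mul_le_mul_of_nonneg_left (hε₀aCE.trans (min_le_left _ _)) h7.le).trans_eq (mul_inv_cancel₀ h7.ne')
  -- `δ(1 + B_H C₂♭) ≤ a₃/2`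
  have hδt : (B₁ * ε₀) * (1 + BH * C2f) ≤ a₃ / 2 := by
    have h1 : B₁ * ε₀ ≤ B₁ * aCE := mul_le_mul_of_nonneg_left hε₀aCE hB₁
    have h2 : B₁ * aCE ≤ B₁ * (a₃ / (2 * (1 + BH * C2f) * (B₁ + 1))) := mul_le_mul_of_nonneg_left haCEa hB₁
    have h3 : B₁ * (a₃ / (2 * (1 + BH * C2f) * (B₁ + 1))) * (1 + BH * C2f) = (a₃ / 2) * (B₁ / (B₁ + 1)) := by
      field_simp
    have h4 : B₁ / (B₁ + 1) ≤ 1 := by rw [div_le_one (by linarith only [hB₁])]; linarith only [hB₁]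
    have h5 : 0 ≤ 1 + BH * C2f := by positivity
    calc (B₁ * ε₀) * (1 + BH * C2f) ≤ B₁ * (a₃ / (2 * (1 + BH * C2f) * (B₁ + 1))) * (1 + BH * C2f) :=
          mul_le_mul_of_nonneg_right (h1.trans h2) h5
      _ = (a₃ / 2) * (B₁ / (B₁ + 1)) := h3
      _ ≤ (a₃ / 2) * 1 := mul_le_mul_of_nonneg_left h4 (by linarith only [ha₃])
      _ = a₃ / 2 := mul_one _
  have hδa : B₁ * ε₀ ≤ a₃ / 2 := by
    have : B₁ * ε₀ ≤ (B₁ * ε₀) * (1 + BH * C2f) := le_mul_of_one_le_right hδ0 (by linarith only [mul_nonneg hBH hC2f0])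
    exact this.trans hδt
  have hδ1 : B₁ * ε₀ ≤ 1 := by linarith only [hδa, ha₃1]
  have hδε : B₁ * ε₀ ≤ ε := by linarith only [hδa, ha₃, ha₃R, hRcε]
  have hr_lt : B₁ * ε₀ + BH * (C2f * (B₁ * ε₀) ^ 2) < a₃ := by
    have h1 : BH * (C2f * (B₁ * ε₀) ^ 2) ≤ BH * (C2f * (B₁ * ε₀)) :=
      mul_le_mul_of_nonneg_left (mul_le_mul_of_nonneg_left (by nlinarith only [hδ0, hδ1]) hC2f0) hBH
    have h2 : B₁ * ε₀ + BH * (C2f * (B₁ * ε₀)) = (B₁ * ε₀) * (1 + BH * C2f) := by ring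
    linarith only [h1, h2, hδt, ha₃]
  have hδRs : B₁ * ε₀ < (16 * 3800 * ((((2 + 1 + 2) * (ℓ + 1) : ℕ)) : ℝ) ^ 2 * ((ℓ + 1 : ℕ) : ℝ))⁻¹ / 4 := by
    linarith only [hδa, ha₃, ha₃R, hRcε, h3ε]
  have htE : C2f * (B₁ * ε₀) ^ 2 ≤ 4 * C2f * ε ^ 2 := by
    have h1 : (B₁ * ε₀) ^ 2 ≤ ε ^ 2 := pow_le_pow_left₀ hδ0 hδε 2
    have h2 : 0 ≤ C2f * ε ^ 2 := by positivity
    have h3 : C2f * (B₁ * ε₀) ^ 2 ≤ C2f * ε ^ 2 := mul_le_mul_of_nonneg_left h1 hC2f0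
    linarith only [h2, h3]
  have hballnum : a₃ + BH * (4 * C2f * ε ^ 2) ≤ (16 * 3800 * ((((2 + 1 + 2) * (ℓ + 1) : ℕ)) : ℝ) ^ 2 * ((ℓ + 1 : ℕ) : ℝ))⁻¹ := by
    have h1 : (1 + 4 * BH * C2f * ε) * ε = ε + BH * (4 * C2f * ε ^ 2) := by ring
    have h2 := HalvingDressingLetter.radFlat_le_quarter_Rs ℓ
    rw [h1] at hR'
    linarith only [hR', h2, ha₃R, hRcε, hRs0]
  -- the weights of record and the cube sequence's admissibility at this member
  set 𝒟 := cubeSeqMT3 (⟨ℓ + 1, hLF, m, hm⟩ : T3Family) n K x ρ S ((ℓ + 1) * (ℓ + 1) ^ a') hM with h𝒟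
  set w₀ : ℕ → PBond ((⟨ℓ + 1, hLF, m, hm⟩ : T3Family).P K) 0 → ℝ := fun m' b =>
    (((ℓ + 1 : ℕ) : ℝ) ^ levOf (fun j => {y : Site ((⟨ℓ + 1, hLF, m, hm⟩ : T3Family).P K) 0 | 𝒟.InOm j y}) (K - n) b.src *
      (((ℓ + 1 : ℕ) : ℝ)⁻¹) ^ (K - n)) ^ m' with hw₀def
  have hw : IsLevWeight (⟨ℓ + 1, hLF, m, hm⟩ : T3Family) n K 𝒟 w₀ := fun _ _ => rfl
  have hDk : 𝒟.k = K - n := cubeSeqMT3_k _ n K x ρ S _ hM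
  have hAdm : Adm22 𝒟 R ((ℓ + 1) * (ℓ + 1) ^ a') := adm22_cubeSeqMT3 _ n K x ρ hM hRS
  have hRL : 2 * ((⟨ℓ + 1, hLF, m, hm⟩ : T3Family).P K).L ≤ R := hR2L
  have hRM1 : 2 * ((⟨ℓ + 1, hLF, m, hm⟩ : T3Family).P K).L ≤ R * ((ℓ + 1) * (ℓ + 1) ^ a') + 1 := by
    show 2 * (ℓ + 1) ≤ R * ((ℓ + 1) * (ℓ + 1) ^ a') + 1
    omega
  have hcollar := Prop8Chart.collar_of_adm22 𝒟 hAdm hRM1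
  have hLS' : ℓ + 1 ≤ S := le_trans (by omega) (hRM.trans hRS)
  have hLS : (⟨ℓ + 1, hLF, m, hm⟩ : T3Family).L ≤ S := hLS'
  have hRsle : 16 * 3800 * ((((2 + 1 + 2) * (ℓ + 1) : ℕ)) : ℝ) ^ 2 * ((ℓ + 1 : ℕ) : ℝ) *
      (16 * 3800 * ((((2 + 1 + 2) * (ℓ + 1) : ℕ)) : ℝ) ^ 2 * ((ℓ + 1 : ℕ) : ℝ))⁻¹ ≤ 1 :=
    (mul_inv_cancel₀ hden.ne').le
  -- the P2 rows at the member (the text's `H` is the canonical `flatH`)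
  obtain ⟨H, Gt, hFH, -, -, -, -, dBI, hdom, h162, hHd⟩ :=
    hP2L ⟨ℓ + 1, hLF, m, hm⟩ rfl n K hnK R ((ℓ + 1) * (ℓ + 1) ^ a') hR₀ hM₀ ⟨a' + 1, by rw [pow_succ']⟩ 𝒟 hDk hAdm w₀ hw
  have hHeq : H = flatH (⟨ℓ + 1, hLF, m, hm⟩ : T3Family) n K 𝒟 :=
    LinearMap.ext fun X => funext fun b => (hFH X b).trans (isFlatH_flatH (F := ⟨ℓ + 1, hLF, m, hm⟩) (n := n) (K := K) (D := 𝒟) X b).symm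
  rw [hHeq] at hHd
  -- FILE E's objects at the member
  obtain ⟨Hs, Dsel, W₀, hHs, hHinv, hHrows, hE4, -, hE6, -, -, -, -, -, hE11, -, hE13⟩ :=
    hEall m hm n K (by omega) (by omega) (Mh := (ℓ + 1) ^ a') rfl hMhE hR₀E x ρ S hM hRS w₀ hw
  -- read FILE E's objects at the member's own carrier letters
  change (BondIdx 𝒟 → Matrix (Fin 2) (Fin 2) ℂ) →ₗ[ℂ] (PBond ((⟨ℓ + 1, hLF, m, hm⟩ : T3Family).P K) 0 → Matrix (Fin 2) (Fin 2) ℂ) at Hs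
  change (PBond ((⟨ℓ + 1, hLF, m, hm⟩ : T3Family).P K) 0 → Matrix (Fin 2) (Fin 2) ℂ) → BondIdx 𝒟 → Matrix (Fin 2) (Fin 2) ℂ at Dsel
  change (PBond ((⟨ℓ + 1, hLF, m, hm⟩ : T3Family).P K) 0 → Matrix (Fin 2) (Fin 2) ℂ) →
    (PBond ((⟨ℓ + 1, hLF, m, hm⟩ : T3Family).P K) 0 → Matrix (Fin 2) (Fin 2) ℂ) at W₀
  have h165 := h165all m hm n K (by omega) (by omega) (Mh := (ℓ + 1) ^ a') rfl hMhr hR₀r hM x ρ S hRS hρ1 w₀ hw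
  obtain ⟨Uc, hUc, -⟩ := exists_su2Chart_continuous (P := (⟨ℓ + 1, hLF, m, hm⟩ : T3Family).P K) ((((ℓ + 1 : ℕ) : ℝ)⁻¹) ^ (K - n))
  obtain ⟨h1, h2⟩ := hiii w₀ hw
  -- B3: the size of `C♭ A`
  set C : (PBond ((⟨ℓ + 1, hLF, m, hm⟩ : T3Family).P K) 0 → Matrix (Fin 2) (Fin 2) ℂ) → BondIdx 𝒟 → Matrix (Fin 2) (Fin 2) ℂ := fun Y i =>
    chartLogFlat ((((ℓ + 1 : ℕ) : ℝ)⁻¹) ^ (K - n)) 𝒟 Y i -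
      (fderiv ℂ (chartLogFlat ((((ℓ + 1 : ℕ) : ℝ)⁻¹) ^ (K - n)) 𝒟 :
        (PBond ((⟨ℓ + 1, hLF, m, hm⟩ : T3Family).P K) 0 → Matrix (Fin 2) (Fin 2) ℂ) → BondIdx 𝒟 → Matrix (Fin 2) (Fin 2) ℂ) 0) Y i with hCdef
  have hCA : ∀ c, ‖C A c‖ ≤ C2f * (B₁ * ε₀) ^ 2 := fun c =>
    (chartRemainderFlat_hCd_hCq_B1 (⟨ℓ + 1, hLF, m, hm⟩ : T3Family) n K hRL hM 𝒟 hDk hAdm hw).2 A (B₁ * ε₀) hδRs h1 c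
  have hCA' : ∀ c, ‖C A c‖ ≤ 4 * C2f * ε ^ 2 := fun c => (hCA c).trans htE
  -- L1: the size of `A′ := A + Hs (C A)`; the ball
  have hAR : ∀ b, w₀ 1 b * ‖A b‖ < (16 * 3800 * ((((2 + 1 + 2) * (ℓ + 1) : ℕ)) : ℝ) ^ 2 * ((ℓ + 1 : ℕ) : ℝ))⁻¹ := fun b =>
    lt_of_le_of_lt (h1 b) (by linarith only [hδRs, hRs0])
  obtain ⟨hsa', htr', -, hsz1, -⟩ := aPrime_rows (⟨ℓ + 1, hLF, m, hm⟩ : T3Family) n K 𝒟 hDk hRL hM hAdm hcollar hw Hs hHs (B₀ := BH)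
    (fun X t hX => (hHrows X t hX).1) (fun X t hX => (hHrows X t hX).2) hsa htr hiv (δ := B₁ * ε₀) (δ' := B₁ * ε₀)
    (R := (16 * 3800 * ((((2 + 1 + 2) * (ℓ + 1) : ℕ)) : ℝ) ^ 2 * ((ℓ + 1 : ℕ) : ℝ))⁻¹) hδRs h1 h2 hRsle hAR
  have hA'r₁ : ∀ b, w₀ 1 b * ‖(A + Hs (C A)) b‖ < a₃ := fun b => lt_of_le_of_lt (hsz1 b) hr_lt
  have hA'ε : ∀ b, w₀ 1 b * ‖(A + Hs (C A)) b‖ < ε := fun b => (hA'r₁ b).trans_le (ha₃R.trans hRcε.le)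
  have hballε : ∀ X : PBond ((⟨ℓ + 1, hLF, m, hm⟩ : T3Family).P K) 0 → Matrix (Fin 2) (Fin 2) ℂ,
      (∀ b, w₀ 1 b * ‖X b‖ < a₃) → ∀ b, w₀ 1 b * ‖X b‖ < ε := fun X hX b => (hX b).trans_le (ha₃R.trans hRcε.le)
  have hw1 : ∀ b, 0 ≤ w₀ 1 b := fun b => levWeight_nonneg hw 1 b
  have hball : ∀ X : PBond ((⟨ℓ + 1, hLF, m, hm⟩ : T3Family).P K) 0 → Matrix (Fin 2) (Fin 2) ℂ, (∀ b, w₀ 1 b * ‖X b‖ < a₃) →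
      ∀ b, w₀ 1 b * ‖(X - Hs (Dsel X)) b‖ < (16 * 3800 * ((((2 + 1 + 2) * (ℓ + 1) : ℕ)) : ℝ) ^ 2 * ((ℓ + 1 : ℕ) : ℝ))⁻¹ := by
    intro X hX b
    have hsz := (hE6 X (hballε X hX)).1
    have hrow : w₀ 1 b * ‖Hs (Dsel X) b‖ ≤ BH * (4 * C2f * ε ^ 2) := (hHrows (Dsel X) _ hsz).1 b
    have hsub : ‖(X - Hs (Dsel X)) b‖ ≤ ‖X b‖ + ‖Hs (Dsel X) b‖ := by rw [Pi.sub_apply]; exact norm_sub_le _ _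
    have h3 := mul_le_mul_of_nonneg_left hsub (hw1 b)
    rw [mul_add] at h3
    linarith only [hX b, hrow, h3, hballnum]
  -- the identification `Dsel A′ = C A` and the chart identity for `A′ − Hs (Dsel A′) = A`
  have h49A : chartLogFlat ((((ℓ + 1 : ℕ) : ℝ)⁻¹) ^ (K - n)) 𝒟 ((A + Hs (C A)) - Hs (C A)) -
      (fderiv ℂ (chartLogFlat ((((ℓ + 1 : ℕ) : ℝ)⁻¹) ^ (K - n)) 𝒟 :
        (PBond ((⟨ℓ + 1, hLF, m, hm⟩ : T3Family).P K) 0 → Matrix (Fin 2) (Fin 2) ℂ) → BondIdx 𝒟 → Matrix (Fin 2) (Fin 2) ℂ) 0) ((A + Hs (C A)) - Hs (C A)) =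
      C A := by
    rw [add_sub_cancel_right]
    rfl
  have hDA : Dsel (A + Hs (C A)) = C A := ((hE6 _ hA'ε).2.2.2.1 (C A) hCA' h49A).symm
  have hZA : (A + Hs (C A)) - Hs (Dsel (A + Hs (C A))) = A := by rw [hDA, add_sub_cancel_right]
  -- F2: the □₀ geometry and the SU(2) normalisation of the P1♭′ chart
  obtain ⟨uS, hchartNear⟩ := hchartNear_of_hii' (n := n) x ρ S ((ℓ + 1) * (ℓ + 1) ^ a') U u A htr hii
  -- the local competitor map and its regular centre `Φloc A′ = uS • U`
  set Φloc : (PBond ((⟨ℓ + 1, hLF, m, hm⟩ : T3Family).P K) 0 → Matrix (Fin 2) (Fin 2) ℂ) →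
      GaugeField ((⟨ℓ + 1, hLF, m, hm⟩ : T3Family).P K) 0 (Matrix.specialUnitaryGroup (Fin 2) ℂ) := fun X b =>
    if (b.src ∈ cubeSetM x (K - n) ρ S ((ℓ + 1) * (ℓ + 1) ^ a') 0 ∧ b.tgt ∈ cubeSetM x (K - n) ρ S ((ℓ + 1) * (ℓ + 1) ^ a') 0)
    then Uc (X - Hs (Dsel X)) b else GaugeField.gaugeAct uS U b with hΦloc
  have hdress : ∀ X : PBond ((⟨ℓ + 1, hLF, m, hm⟩ : T3Family).P K) 0 → Matrix (Fin 2) (Fin 2) ℂ, (∀ b, IsSelfAdjoint (X b)) → (∀ b, Matrix.trace (X b) = 0) →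
      (∀ b, w₀ 1 b * ‖X b‖ < a₃) → (∀ b, IsSelfAdjoint ((X - Hs (Dsel X)) b)) ∧ ∀ b, Matrix.trace ((X - Hs (Dsel X)) b) = 0 := fun X hXsa hXtr hXS =>
    dressed_competitor_su2 (⟨ℓ + 1, hLF, m, hm⟩ : T3Family) n K 𝒟 hDk hcollar hw hRsle (⇑Hs)
      (fun b c => flatH (⟨ℓ + 1, hLF, m, hm⟩ : T3Family) n K 𝒟 (Pi.single c 1) b *
        (((ℓ + 1 : ℕ) : ℝ) ^ (c.1.1 : ℕ) * (((ℓ + 1 : ℕ) : ℝ)⁻¹) ^ (K - n))⁻¹)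
      hHs hXsa hXtr (hball X hXS) (hE6 X (hballε X hXS)).2.1 (hE6 X (hballε X hXS)).1 (hE6 X (hballε X hXS)).2.2.2.1
  have hΦA : Φloc (A + Hs (C A)) = GaugeField.gaugeAct uS U := by
    funext b
    by_cases hb : (b.src ∈ cubeSetM x (K - n) ρ S ((ℓ + 1) * (ℓ + 1) ^ a') 0 ∧ b.tgt ∈ cubeSetM x (K - n) ρ S ((ℓ + 1) * (ℓ + 1) ^ a') 0)
    · have hdA := hdress _ hsa' htr' hA'r₁
      rw [hΦloc]; dsimp only; rw [if_pos hb]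
      exact Subtype.ext (by rw [hUc _ hdA.1 hdA.2 b, hZA, hchartNear b hb])
    · rw [hΦloc]; dsimp only; rw [if_neg hb]
  have hregA : RegPr (⟨ℓ + 1, hLF, m, hm⟩ : T3Family) n K ε₀ (Φloc (A + Hs (C A))) := by
    rw [hΦA]; exact regPr_gaugeAct_of_mem_regFibrePr _ n K ε₀ hε₀.le hU uS
  -- (G): the differentiable gauge fix on every `T`-direction line, DISCHARGED by ✓`exists_smoothGauge_mem_fibre_of_chart49_line` + the regular radius
  have hgauge : ∀ s : PBond ((⟨ℓ + 1, hLF, m, hm⟩ : T3Family).P K) 0 → ℝ, QE 𝒟 (WithLp.toLp 2 s) = 0 → ∀ Et : Matrix (Fin 2) (Fin 2) ℂ, IsSelfAdjoint Et → Matrix.trace Et = 0 →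
      ∃ r : ℝ, 0 < r ∧ ∃ h : ℝ → GaugeTransf ((⟨ℓ + 1, hLF, m, hm⟩ : T3Family).P K) 0 (Matrix.specialUnitaryGroup (Fin 2) ℂ),
        (∀ t : ℝ, |t| < r → GaugeField.gaugeAct (h t) (Φloc ((A + Hs (C A)) + t • fun b => ((s b : ℝ) : ℂ) • Et)) ∈
          fibre (⟨ℓ + 1, hLF, m, hm⟩ : T3Family) ℰp n K hnK.le V) ∧
        ∀ x, DifferentiableAt ℝ (fun t => ((h t x : Matrix.specialUnitaryGroup (Fin 2) ℂ) : Matrix (Fin 2) (Fin 2) ℂ)) 0 := by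
    intro s hs Et hEt hEttr
    -- the direction `Y = s•Et` is 𝔰𝔲(2)-valued with zero index averages; the line stays in the `a₃`-ball for small `t`
    have hQs : ∀ c : BondIdx 𝒟, bondAvgIter (c.1.1 : ℕ) s c.1.2 = 0 := fun c => by
      have h := congrArg (fun v : B6SectAOperatorsV1.BondIdxSpace 𝒟 => v c) hs
      simpa [B6SectAOperatorsV1.QE_apply] using h
    have hδφ : (fun b => ((s b : ℝ) : ℂ) • Et) = fun b => (LinearMap.toSpanSingleton ℝ (Matrix (Fin 2) (Fin 2) ℂ) Et) (s b) := by
      funext b; rw [LinearMap.toSpanSingleton_apply, Complex.coe_smul]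
    have hYQ : ∀ c : BondIdx 𝒟, bondAvgIter (c.1.1 : ℕ) (fun b => ((s b : ℝ) : ℂ) • Et) c.1.2 = 0 := fun c => by
      rw [hδφ, ChartHInv.bondAvgIter_comp_apply (LinearMap.toSpanSingleton ℝ (Matrix (Fin 2) (Fin 2) ℂ) Et) (c.1.1 : ℕ) s c.1.2, hQs c, map_zero]
    have hYsa : ∀ t : ℝ, ∀ b, IsSelfAdjoint (((A + Hs (C A)) + t • fun b => ((s b : ℝ) : ℂ) • Et) b) := fun t b => by
      show IsSelfAdjoint ((A + Hs (C A)) b + t • (((s b : ℝ) : ℂ) • Et))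
      rw [Complex.coe_smul]
      exact (hsa' b).add (IsSelfAdjoint.smul (IsSelfAdjoint.all t) (IsSelfAdjoint.smul (IsSelfAdjoint.all (s b)) hEt))
    have hYtr : ∀ t : ℝ, ∀ b, Matrix.trace (((A + Hs (C A)) + t • fun b => ((s b : ℝ) : ℂ) • Et) b) = 0 := fun t b => by
      show Matrix.trace ((A + Hs (C A)) b + t • (((s b : ℝ) : ℂ) • Et)) = 0
      rw [Matrix.trace_add, Matrix.trace_smul, Matrix.trace_smul, htr' b, hEttr, smul_zero, smul_zero, add_zero]
    obtain ⟨r₀, hr₀, hrS⟩ := exists_lineRadius_of_mem_weightedBall (w₀ 1) hw1 hA'r₁ (fun b => ((s b : ℝ) : ℂ) • Et)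
    -- file C on the line
    obtain ⟨hl, hfib, hhd, hWd⟩ := exists_smoothGauge_mem_fibre_of_chart49_line _ n K 𝒟 hDk hcollar hw hRsle Hs Dsel (r₁ := a₃)
      (fun Y hY => (hE6 Y (hballε Y hY)).2.1) hHinv hball (fun Y hY => (hE4 Y (hballε Y hY)).differentiableAt) hA'r₁ hYQ hrS hnK.le hε₀ hε7 hU uS _
      (near_of_bondIdx _ n K x ρ S _ hM hLS) (near_of_mem_Om_succ _ n K x ρ S _ hM)
      (fun b hb => by rw [hZA]; exact hchartNear b hb) (fun t => Φloc ((A + Hs (C A)) + t • fun b => ((s b : ℝ) : ℂ) • Et))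
      (fun t ht b hb => by
        have hd := hdress _ (hYsa t) (hYtr t) (hrS t ht)
        rw [hΦloc]; dsimp only; rw [if_pos hb]; exact hUc _ hd.1 hd.2 b)
      (fun t b hb => by rw [hΦloc]; dsimp only; rw [if_neg hb])
    -- the regular radius of the line
    obtain ⟨r', hr', hreg'⟩ := exists_lineRadius_regPr_of_differentiableAt_bonds _ n K ε₀ Φloc (A + Hs (C A)) (fun b => ((s b : ℝ) : ℂ) • Et) hregA
      (hWd 0 (by simpa using hr₀))
    exact ⟨min r₀ r', lt_min hr₀ hr', hl, fun t ht => hfib t (lt_of_lt_of_le ht (min_le_left _ _)) (hreg' t (lt_of_lt_of_le ht (min_le_right _ _))),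
      hhd 0 (by simpa using hr₀)⟩
  -- L3′
  obtain ⟨h165rows, h157, hnear, hfar⟩ := ceRows_at_member_stat (⟨ℓ + 1, hLF, m, hm⟩ : T3Family) n K hnK x ρ S ((ℓ + 1) * (ℓ + 1) ^ a') R hM hρ1
    hRS hRM hRL hw hHd h162 hdom hδ₀.le hB₀.le hB₃.le hsa htr hiv (δ := B₁ * ε₀) (ε₁ := ε₁) hδ0 h1 h2 hvi Hs hHs hHinv hBH hHrows Dsel hE4 hE6
    W₀ hE11 (by positivity) hE13 h165 Uc hUc
    (fun b => b.src ∈ cubeSetM x (K - n) ρ S ((ℓ + 1) * (ℓ + 1) ^ a') 0 ∧ b.tgt ∈ cubeSetM x (K - n) ρ S ((ℓ + 1) * (ℓ + 1) ^ a') 0)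
    _ (near_sides_of_touch (n := n) x ρ S _ hM (le_trans (by omega) hLS')) (lamBond_sides_of_not_touch 𝒟) ε₀ V hstat hU uS hchartNear hgauge
    hδRs (ha₃R.trans hRcε.le) hr_lt hr_lt htE hballnum
  have hsq : B₁ ^ 2 ≤ (B₁ + 1) ^ 2 := by nlinarith only [hB₁]
  have he₃ : ∀ q : ℝ, q = C2f → B₀ * B₃ * (q * (B₁ * ε₀) ^ 2) ≤ B₀ * B₃ * C2f * (B₁ + 1) ^ 2 * ε₀ ^ 2 := by
    intro q hq
    subst hq
    have h0 : 0 ≤ B₀ * B₃ * C2f := by positivity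
    calc B₀ * B₃ * (C2f * (B₁ * ε₀) ^ 2) = B₀ * B₃ * C2f * B₁ ^ 2 * ε₀ ^ 2 := by ring
      _ ≤ B₀ * B₃ * C2f * (B₁ + 1) ^ 2 * ε₀ ^ 2 :=
          mul_le_mul_of_nonneg_right (mul_le_mul_of_nonneg_left hsq h0) (by positivity)
  refine ⟨⇑Hs, C, _, _, h165rows, h157, hnear, fun c hc => (hfar c hc).trans ?_, ?_, he₃ _ rfl⟩
  · -- far: `L·r·L^{k−j} ≤ L(1 + B_H C₂♭)(B₁+1)ε₀·L^{k−j}`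
    exact mul_le_mul_of_nonneg_right (r_le_growth hL0.le hBH hC2f0 le_rfl hB₁ hε₀.le hδ1) (by positivity)
  · -- `e₁ ≤ k₁(B₁+1)²ε₀²`
    exact e₁_bound_growth hB₀r hBH (by positivity) le_rfl hC2f0 le_rfl hB₁ hε₀.le hδ1
end Summit.QuantumFields.YangMills.Theorems.HalvingSitePackage

end
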